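import Summits.ABC.IUTFork.Conditional.WRowLicenceSocketMOfK
import Summits.ABC.IUTFork.Conditional.InhUniformBandFrey1618481116086272
import HarnessLib

/-!
# Branch C / R-W, reading (U), M line: the M-SETTING twin of the HAND-BUILT kernel INHABITED theorem `WRow.licence_frey1618481116086272_uniform`
# (`Conditional/InhUniformBandFrey1618481116086272`; point `ratPoint (2 ^ 46 * 23 / 19 ^ 11 * 59 * 7207)`; binders `{l : ℕ} (hL : 148540 ≤ l)`)
# (abc-iut cell, branch C, row «C:INH-M-TWIN-RESIDUE»; seat abc-iut-C-cert-2 gen 8; C LEAD KEY 2026-08-27T13:11Z; work list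
# abc-iut-rw-num-lead's `plan/rescue/R-W/M-TWIN-GAP-INH.tsv`)

Record-only PROOF file (D-0012; 0 definitions, 0 `Prop` facts, nothing re-typed) of the abc-iut cell. TAKES NO SIDE on [IUTchIII] Cor. 3.12
(S. Mochizuki, *Inter-universal Teichmüller theory III*, Cor. 3.12 p. 173–174; Step (xi-f) p. 184) or on any author; «inhabited as typed» ≠
«asserted in print».

The K theorem is HAND-BUILT over abc-iut-w4-d036's K orders socket `Cor312Prov.licence_settingPrVolSharp_pilotDataOfK_of_orders_rat`: its
proof names per-prime integers `(e, D, h, ρin, ρout)` and discharges a LOCAL PACKAGE at every bad K-fibre point and the integer CELLS at every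
label (the W lane's lemmas, credited in the K file, all BY NAME here). This seat's transfer socket `WRowM.licence_tOfIdeleData_of_ordersK_rat`
(`WRowLicenceSocketMOfK`, gen 8) takes THE SAME two hypothesis functions — so the M twin below is the K proof by SURGERY (generator
`tools/gen_handbuilt_m.py`): conclusion binders ↦ the M-level ones, `intro` line ↦ the M context, final `refine` ↦ the transfer socket (the
K socket's `hiso` argument dropped); EVERY per-prime package line and EVERY cell line is the K file's, VERBATIM (no number re-derived; the
K file's arithmetic certificates and shape lemmas BY NAME through the import). Conclusion = `Thm311ToCor312.Licence` at the M-LEVEL setting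
of the datum's own ideles `settingPrVolSharpM T.D hlog (tOfIdeleData T.D r) (tqM … r …) …` for EVERY idele datum `r`, every analytic
`logvK`, any `htq0/Sq/htq1` — the setting of the M books of record (`abc_of_SH_v11M_window_content` p461893 and its Szpiro-bad / stable
companions), whose (U) binder therefore reads INHABITED AS TYPED where the K theorem says.

* **`WRowM.licence_frey1618481116086272_uniform_M`** — M twin of `WRow.licence_frey1618481116086272_uniform` (binders VERBATIM).

HONEST SCOPE: OUR sharp containers and Dupuy–Hilado's typed (Ind1)/(Ind2); STRONGER-THAN-PRINT hull reading; a socket discharges nothing;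
non-emptiness of the datum type, admissibility and Szpiro-badness NOT claimed; explicit hypothesis counts of the record books UNCHANGED; an M
twin changes NO K-line census count; nothing about the printed GLOBAL inequality or the number-level corollary; typed ≠ proved; instantiated ≠
endorsed; no abc claim. [cite: Mochizuki2012, IUTchI Def. 3.1 (b),(c) pp. 61–62, Rmk. 3.1.5 p. 65, Ex. 3.2 (iv) p. 71; IUTchIII Cor. 3.12
Step (xi-f) p. 184; IUTchIV Prop. 1.1 p. 9, Prop. 1.2 (i)(ii) p. 10, Prop. 1.4 (ii) p. 13, Cor. 2.2 (ii) proof (P5) p. 46]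
[cite: DupuyHilado2025, §3.3, §3.4, §4.9, §4.12] [cite: NeukirchANT1999, Ch. II (5.5)–(5.7)] [cite: SilvermanAEC2009, Prop. III.1.7(b)]
[claim: Mochizuki2012, status: disputed] for every IUT sentence. PROOF-ONLY: no definitions.
-/

noncomputable section

open Set Function Metric NumberField IsDedekindDomain

namespace Summit.ABC.IUTFork.Conditional

open Thm311 Thm311.Real Cor312 Cor312Vol Cor312Prov Literature.IUT.LogThetaLattice Literature.IUT.LogVolume
  Literature.IUT.HodgeTheaters Literature.IUT.LogVolume.Cor22
open Literature.NumberTheory.NumberFields Literature.NumberTheory.GaloisRepresentations.Ultrametric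
open Literature.NumberTheory.DiophantineGeometry Literature.NumberTheory.DiophantineGeometry.GenEll

set_option maxHeartbeats 1600000 in
/-- **M TWIN of `WRow.licence_frey1618481116086272_uniform`** (`Conditional/InhUniformBandFrey1618481116086272`; binders `{l : ℕ} (hL : 148540 ≤ l)` VERBATIM): for EVERY genuine Θ-volume datum `T` at `ratPoint (2 ^ 46 * 23 / 19 ^ 11 * 59 * 7207)` (level as bound)
and EVERY idele datum `r` of `T.D`, `Thm311ToCor312.Licence` at the M-LEVEL setting `settingPrVolSharpM T.D hlog (tOfIdeleData T.D r) (tqM … r …) …` —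
the K file's per-prime packages and cells VERBATIM, fed to this seat's transfer socket `WRowM.licence_tOfIdeleData_of_ordersK_rat`. The M books'
(U) binder is INHABITED AS TYPED there. K docstring, for the record: «**"W:INH-BANDS-REFUTED-SIDE", INHABITED SIDE, UNCONDITIONAL — `2⁴⁶·23 + 3⁹·5⁵·11⁷·31²·43 = 19¹¹·59·7207` at EVERY level `l ≥ 148540`.** For EVERY prime `l ≥ 148540`, EVERY genuine Θ-volume datum `T` at `(ratPoint(((2 ^ 46 * 23 : ℕ) : ℚ) / (19 ^ 11 * 59 * 7207 : ℕ)), l)` and EVERY pair of Θ- and q-ideles realising the pilot divisors of `X := pilotDataOfK T.D T.K`, abc-iut-c312-1's `Thm311ToCor312.Licence` HOLDS at abc-iut-c312-7's `settingPrVolSharp X …`. NO local-type and NO conjugacy hypothesis: the bad primes are `{3, 5, 11, 19, 23, 31, 43, 59, 7207} ∖ {l}` (`WRow.bad_prime_frey1618481116086272`); the bad completions over each are isometrically `ℚ_p`-isomorphic (`d_mod = 1`), so the index »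
[cite: Mochizuki2012, IUTchIII Cor. 3.12 Step (xi-f) p. 184; IUTchIV Prop. 1.2 (i)(ii) p. 10, Cor. 2.2 (ii) proof (P5) p. 46]
[cite: DupuyHilado2025, §3.3, §3.4, §4.9, §4.12] [claim: Mochizuki2012, status: disputed] -/
theorem WRowM.licence_frey1618481116086272_uniform_M {l : ℕ} (hL : 148540 ≤ l) (T : Cor22.ThetaVolumeDatumAt (ratPoint (((2 ^ 46 * 23 : ℕ) : ℚ) / (19 ^ 11 * 59 * 7207 : ℕ))) l) :
    letI := T.instFieldF; letI := T.instNumberFieldF; letI := T.instAlgebraF; letI := T.instFieldK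
    letI := T.instNumberFieldK; letI := T.instAlgebraK; letI := T.instFieldFbar; letI := T.instAlgebraFbar
    letI := T.instAlgebraKFbar; letI := T.instIsElliptic
    ∀ {logvK : PadicLogsVal T.K} (hlog : LogvAnalyticVal logvK) (r : ThetaData.IdeleData T.D) (M : Type) [Field M] [NumberField M]
      (archPk : ∀ (j : (thetaIndexOfInitial T.D).Label) (vQ : (thetaIndexOfInitial T.D).VQ),
        Set ((logShellsOfInitialDH T.D logvK).Packet j vQ))
      (archSub : ∀ (j : (thetaIndexOfInitial T.D).Label) (v : (thetaIndexOfInitial T.D).V),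
        Set ((logShellsOfInitialDH T.D logvK).Packet j ((thetaIndexOfInitial T.D).over v)))
      (Ψ : ℤ → ∀ v : (thetaIndexOfInitial T.D).V, v ∈ (thetaIndexOfInitial T.D).Vbad →
        Set ((logShellsOfInitialDH T.D logvK).StarPacket v))
      (act : ℤ → ∀ v : (thetaIndexOfInitial T.D).V, v ∈ (thetaIndexOfInitial T.D).Vbad →
        (logShellsOfInitialDH T.D logvK).StarPacket v → Module.End ℚ ((logShellsOfInitialDH T.D logvK).StarPacket v))
      (Mmod : ℤ → ∀ j : (thetaIndexOfInitial T.D).LabelStar, Set ((logShellsOfInitialDH T.D logvK).GlobalPacket j.1))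
      (region : ℤ → ∀ j : (thetaIndexOfInitial T.D).LabelStar, FinDivisor M → ∀ vQ : (thetaIndexOfInitial T.D).VQ,
        Set ((logShellsOfInitialDH T.D logvK).Packet j.1 vQ))
      (n : ℤ) {HT : Type} {LogLink : HT → HT → Type} {IsFull : ∀ {s t : HT}, LogLink s t → Prop}
      (lat : LGPGaussianLogThetaLattice LogLink IsFull)
      {Frd : Type} {IsoF : Frd → Frd → Type} {Ob : Frd → Type} {realify : Frd → Frd} {Strip : Type}
      {IsoS : Strip → Strip → Type}
      {Mv : ∀ v : (thetaIndexOfInitial T.D).V, v ∈ (thetaIndexOfInitial T.D).Vbad → Type} [∀ v h, Monoid (Mv v h)]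
      (sig : GlobalLGPFrobenioidSignature (thetaIndexOfInitial T.D).lstar (thetaIndexOfInitial T.D).V
        (· ∈ (thetaIndexOfInitial T.D).Vbad) Frd IsoF Ob realify Strip IsoS Mv)
      (split : SplittingMonoids Mv) {ObΔ : Type}
      {N : ∀ v : (thetaIndexOfInitial T.D).V, v ∈ (thetaIndexOfInitial T.D).Vbad → Type} [∀ v h, Monoid (N v h)]
      (qData : QPilotData ObΔ N)
      (htq0 : ∀ (u : FinitePlace ℚ) (x : (thetaIndexOfInitial T.D).Fibre (Val.non u)),
        tqM T.D (ratChar u) u (natCast_ratChar_mem u) r x ≠ 0)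
      (Sq : Finset (FinitePlace ℚ))
      (htq1 : ∀ (u : FinitePlace ℚ) (x : (thetaIndexOfInitial T.D).Fibre (Val.non u)), u ∉ Sq →
        ‖tqM T.D (ratChar u) u (natCast_ratChar_mem u) r x‖ = 1),
      Thm311ToCor312.Licence
        (settingPrVolSharpM T.D hlog (tOfIdeleData T.D r) (fun u x => tqM T.D (ratChar u) u (natCast_ratChar_mem u) r x) M archPk
          archSub Ψ act Mmod region n lat sig split qData htq0 Sq htq1) := by
  classical
  letI := T.instFieldF; letI := T.instNumberFieldF; letI := T.instAlgebraF; letI := T.instFieldK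
  letI := T.instNumberFieldK; letI := T.instAlgebraK; letI := T.instFieldFbar; letI := T.instAlgebraFbar
  letI := T.instAlgebraKFbar; letI := T.instIsElliptic
  intro logvK hlog r M _ _ archPk archSub Ψ act Mmod region n HT LogLink IsFull lat Frd IsoF Ob realify Strip IsoS Mv _ sig split ObΔ N _
    qData htq0 Sq htq1
  have hjF : T.E.j = ((jInv (((2 ^ 46 * 23 : ℕ) : ℚ) / (19 ^ 11 * 59 * 7207 : ℕ)) : ℚ) : T.F) := by rw [T.j_eq]; exact eq_ratCast _ _
  have hl5 : 5 ≤ l := T.D.five_le_l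
  have hlP : l.Prime := T.D.l_prime
  have hlstar : (pilotDataOfK T.D T.K).lstar = (l - 1) / 2 := by
    show ((pilotDataOfK T.D T.K).l - 1) / 2 = (l - 1) / 2
    rw [pilotDataOfK_l]
  have hFm : Module.finrank ℚ (fieldOfModuli T.E) = 1 := by
    rw [T.finrank_rat_fieldOfModuli_eq_dmod]
    exact dmod_eq_one_of_degree_le_one (by rw [degree_ratPoint])
  set eF : Nat.Primes → ℕ := fun pp =>
    haveI : Fact (pp : ℕ).Prime := ⟨pp.2⟩
    if h : ∃ x : (thetaIndex (pilotDataOfK T.D T.K)).Fibre (.inr pp), placeOf (pilotDataOfK T.D T.K) pp.1 x ∈ (pilotDataOfK T.D T.K).S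
    then absRamificationIdx (pp : ℕ) (kOf (pilotDataOfK T.D T.K) pp.1 h.choose) else 1 with heF
  set DF : Nat.Primes → ℕ := fun pp => eF pp - 1 with hDF
  set hF : Nat.Primes → ℕ := fun pp => if (pp : ℕ) = 3 then 18 else if (pp : ℕ) = 5 then 10 else if (pp : ℕ) = 11 then 14 else if (pp : ℕ) = 19 then 22 else if (pp : ℕ) = 23 then 2 else if (pp : ℕ) = 31 then 4 else if (pp : ℕ) = 43 then 2 else if (pp : ℕ) = 59 then 2 else 2 with hhF
  set rinF : Nat.Primes → ℤ := fun pp => if (pp : ℕ) = 19 then (((eF pp / 18 : ℕ)) : ℤ) else 1 with hrinF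
  set routF : Nat.Primes → ℤ := fun pp => if (pp : ℕ) = 3 then min ((3 : ℤ) ^ 4 - 4 * (eF pp : ℤ)) ((3 : ℤ) ^ 5 - 5 * (eF pp : ℤ)) else
      if (pp : ℕ) = 5 then min ((5 : ℤ) ^ 2 - 2 * (eF pp : ℤ)) ((5 : ℤ) ^ 3 - 3 * (eF pp : ℤ)) else
      if (pp : ℕ) = 11 then min ((11 : ℤ) ^ 3 - 3 * (eF pp : ℤ)) ((11 : ℤ) ^ 4 - 4 * (eF pp : ℤ)) else
      if (pp : ℕ) = 19 then min ((19 : ℤ) ^ 5 - 5 * (eF pp : ℤ)) ((19 : ℤ) ^ 6 - 6 * (eF pp : ℤ)) else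
      if (pp : ℕ) = 23 then min ((23 : ℤ) ^ 0 - 0 * (eF pp : ℤ)) ((23 : ℤ) ^ 1 - 1 * (eF pp : ℤ)) else
      if (pp : ℕ) = 31 then min ((31 : ℤ) ^ 1 - 1 * (eF pp : ℤ)) ((31 : ℤ) ^ 2 - 2 * (eF pp : ℤ)) else
      if (pp : ℕ) = 43 then min ((43 : ℤ) ^ 0 - 0 * (eF pp : ℤ)) ((43 : ℤ) ^ 1 - 1 * (eF pp : ℤ)) else
      if (pp : ℕ) = 59 then min ((59 : ℤ) ^ 0 - 0 * (eF pp : ℤ)) ((59 : ℤ) ^ 1 - 1 * (eF pp : ℤ)) else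
      min ((7207 : ℤ) ^ 0 - 0 * (eF pp : ℤ)) ((7207 : ℤ) ^ 1 - 1 * (eF pp : ℤ)) with hroutF
  have heq : ∀ (pp : Nat.Primes) (x : (thetaIndex (pilotDataOfK T.D T.K)).Fibre (.inr pp)),
      haveI : Fact (pp : ℕ).Prime := ⟨pp.2⟩
      placeOf (pilotDataOfK T.D T.K) pp.1 x ∈ (pilotDataOfK T.D T.K).S →
        absRamificationIdx (pp : ℕ) (kOf (pilotDataOfK T.D T.K) pp.1 x) = eF pp := by
    intro pp x hx
    haveI : Fact (pp : ℕ).Prime := ⟨pp.2⟩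
    have hex : ∃ x : (thetaIndex (pilotDataOfK T.D T.K)).Fibre (.inr pp),
        placeOf (pilotDataOfK T.D T.K) pp.1 x ∈ (pilotDataOfK T.D T.K).S := ⟨x, hx⟩
    have h1 : eF pp = absRamificationIdx (pp : ℕ) (kOf (pilotDataOfK T.D T.K) pp.1 hex.choose) := by
      simp only [heF, dif_pos hex]
    rw [h1]
    exact WRow.absRamificationIdx_kOf_eq_of_finrank_eq_one T.D hFm pp x hex.choose
  have hshape : ∀ (pp : Nat.Primes) (x : (thetaIndex (pilotDataOfK T.D T.K)).Fibre (.inr pp)),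
      haveI : Fact (pp : ℕ).Prime := ⟨pp.2⟩
      placeOf (pilotDataOfK T.D T.K) pp.1 x ∈ (pilotDataOfK T.D T.K).S →
        ∃ m : ℕ, 1 ≤ m ∧ eF pp = (if (pp : ℕ) = 3 then 10 else if (pp : ℕ) = 5 then 12 else if (pp : ℕ) = 11 then 15 else if (pp : ℕ) = 19 then 30 else if (pp : ℕ) = 23 then 15 else if (pp : ℕ) = 31 then 15 else if (pp : ℕ) = 43 then 15 else if (pp : ℕ) = 59 then 30 else 30) * l * m := by
    intro pp x hx
    rw [← heq pp x hx]
    exact InhBand.shape_frey1618481116086272 T pp x hx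
  refine WRowM.licence_tOfIdeleData_of_ordersK_rat T.D hlog r M archPk archSub Ψ act Mmod region n lat sig split qData htq0 Sq
    htq1 (jInv (((2 ^ 46 * 23 : ℕ) : ℚ) / (19 ^ 11 * 59 * 7207 : ℕ))) hjF eF DF hF rinF routF (fun pp x hx => ?_) (fun pp hpp i => ?_)
  · -- the local packages at a bad place `x | p`
    haveI : Fact (pp : ℕ).Prime := ⟨pp.2⟩
    have hE := heq pp x hx
    obtain ⟨m, hm1, hm⟩ := hshape pp x hx
    obtain ⟨hp2, hpl, -, hcases, hord⟩ := WRow.bad_prime_frey1618481116086272 T pp x hx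
    rcases hcases with hp | hp | hp | hp | hp | hp | hp | hp | hp
    · -- `p = 3`: `e = 10·l·m`, `h = 18`
      simp only [hp] at hm; norm_num at hm
      have h3 : hF pp = 18 := by simp [hhF, hp]
      have hfac' : (2 ^ 46 * 23 * (3 ^ 9 * 5 ^ 5 * 11 ^ 7 * 31 ^ 2 * 43) * (19 ^ 11 * 59 * 7207)).factorization (pp : ℕ) = 9 := by
        rw [hp, WRow.factorization_frey1618481116086272 (by norm_num)]; norm_num
      rw [hfac'] at hord; push_cast at hord
      have hne : ∀ c : ℕ, (eF pp : ℤ) ≠ (((pp : ℕ) : ℕ) : ℤ) ^ c * ((((pp : ℕ) : ℕ) : ℤ) - 1) :=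
        WRow.natCast_ne_pow_mul_sub_one Nat.prime_five pp.2 (by rw [hp]; norm_num) (by rw [hp]; norm_num) ⟨2 * l * m, by rw [hm]; ring⟩
      refine ⟨hE, ?_, ?_, ?_, by rw [h3]; push_cast at hord ⊢; linarith [hord], ⟨90 * m, by rw [h3, hm]; ring⟩⟩
      · rw [show DF pp = eF pp - 1 by simp [hDF]]
        exact Cor312Prov.pred_div_le_differentOrd_of_eq (pp : ℕ) hE
      · rw [show rinF pp = 1 by simp [hrinF, hp]]
        exact WRow.inner_witness_trivial (pp : ℕ) _ (eF pp)
      · exact WRow.outer_member_min (pp : ℕ) hE hne 4 5 (show (((pp : ℕ) : ℕ) : ℤ) = 3 by exact_mod_cast hp) (by simp [hroutF, hp])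
    · -- `p = 5`: `e = 12·l·m`, `h = 10`
      simp only [hp] at hm; norm_num at hm
      have h3 : hF pp = 10 := by simp [hhF, hp]
      have hfac' : (2 ^ 46 * 23 * (3 ^ 9 * 5 ^ 5 * 11 ^ 7 * 31 ^ 2 * 43) * (19 ^ 11 * 59 * 7207)).factorization (pp : ℕ) = 5 := by
        rw [hp, WRow.factorization_frey1618481116086272 (by norm_num)]; norm_num
      rw [hfac'] at hord; push_cast at hord
      have hne : ∀ c : ℕ, (eF pp : ℤ) ≠ (((pp : ℕ) : ℕ) : ℤ) ^ c * ((((pp : ℕ) : ℕ) : ℤ) - 1) :=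
        WRow.natCast_ne_pow_mul_sub_one Nat.prime_three pp.2 (by rw [hp]; norm_num) (by rw [hp]; norm_num) ⟨4 * l * m, by rw [hm]; ring⟩
      refine ⟨hE, ?_, ?_, ?_, by rw [h3]; push_cast at hord ⊢; linarith [hord], ⟨60 * m, by rw [h3, hm]; ring⟩⟩
      · rw [show DF pp = eF pp - 1 by simp [hDF]]
        exact Cor312Prov.pred_div_le_differentOrd_of_eq (pp : ℕ) hE
      · rw [show rinF pp = 1 by simp [hrinF, hp]]
        exact WRow.inner_witness_trivial (pp : ℕ) _ (eF pp)
      · exact WRow.outer_member_min (pp : ℕ) hE hne 2 3 (show (((pp : ℕ) : ℕ) : ℤ) = 5 by exact_mod_cast hp) (by simp [hroutF, hp])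
    · -- `p = 11`: `e = 15·l·m`, `h = 14`
      simp only [hp] at hm; norm_num at hm
      have h3 : hF pp = 14 := by simp [hhF, hp]
      have hfac' : (2 ^ 46 * 23 * (3 ^ 9 * 5 ^ 5 * 11 ^ 7 * 31 ^ 2 * 43) * (19 ^ 11 * 59 * 7207)).factorization (pp : ℕ) = 7 := by
        rw [hp, WRow.factorization_frey1618481116086272 (by norm_num)]; norm_num
      rw [hfac'] at hord; push_cast at hord
      have hne : ∀ c : ℕ, (eF pp : ℤ) ≠ (((pp : ℕ) : ℕ) : ℤ) ^ c * ((((pp : ℕ) : ℕ) : ℤ) - 1) :=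
        WRow.natCast_ne_pow_mul_sub_one Nat.prime_three pp.2 (by rw [hp]; norm_num) (by rw [hp]; norm_num) ⟨5 * l * m, by rw [hm]; ring⟩
      refine ⟨hE, ?_, ?_, ?_, by rw [h3]; push_cast at hord ⊢; linarith [hord], ⟨105 * m, by rw [h3, hm]; ring⟩⟩
      · rw [show DF pp = eF pp - 1 by simp [hDF]]
        exact Cor312Prov.pred_div_le_differentOrd_of_eq (pp : ℕ) hE
      · rw [show rinF pp = 1 by simp [hrinF, hp]]
        exact WRow.inner_witness_trivial (pp : ℕ) _ (eF pp)
      · exact WRow.outer_member_min (pp : ℕ) hE hne 3 4 (show (((pp : ℕ) : ℕ) : ℤ) = 11 by exact_mod_cast hp) (by simp [hroutF, hp])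
    · -- `p = 19`: `e = 30·l·m`, `h = 22`
      simp only [hp] at hm; norm_num at hm
      have h3 : hF pp = 22 := by simp [hhF, hp]
      have hfac' : (2 ^ 46 * 23 * (3 ^ 9 * 5 ^ 5 * 11 ^ 7 * 31 ^ 2 * 43) * (19 ^ 11 * 59 * 7207)).factorization (pp : ℕ) = 11 := by
        rw [hp, WRow.factorization_frey1618481116086272 (by norm_num)]; norm_num
      rw [hfac'] at hord; push_cast at hord
      have hne : ∀ c : ℕ, (eF pp : ℤ) ≠ (((pp : ℕ) : ℕ) : ℤ) ^ c * ((((pp : ℕ) : ℕ) : ℤ) - 1) :=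
        WRow.natCast_ne_pow_mul_sub_one Nat.prime_five pp.2 (by rw [hp]; norm_num) (by rw [hp]; norm_num) ⟨6 * l * m, by rw [hm]; ring⟩
      refine ⟨hE, ?_, ?_, ?_, by rw [h3]; push_cast at hord ⊢; linarith [hord], ⟨330 * m, by rw [h3, hm]; ring⟩⟩
      · rw [show DF pp = eF pp - 1 by simp [hDF]]
        exact Cor312Prov.pred_div_le_differentOrd_of_eq (pp : ℕ) hE
      · rw [show rinF pp = (((eF pp / 18 : ℕ)) : ℤ) by simp [hrinF, hp]]
        exact WRow.inner_witness_slot (pp : ℕ) (by rw [hp]; norm_num) hE (by rw [hp])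
      · exact WRow.outer_member_min (pp : ℕ) hE hne 5 6 (show (((pp : ℕ) : ℕ) : ℤ) = 19 by exact_mod_cast hp) (by simp [hroutF, hp])
    · -- `p = 23`: `e = 15·l·m`, `h = 2`
      simp only [hp] at hm; norm_num at hm
      have h3 : hF pp = 2 := by simp [hhF, hp]
      have hfac' : (2 ^ 46 * 23 * (3 ^ 9 * 5 ^ 5 * 11 ^ 7 * 31 ^ 2 * 43) * (19 ^ 11 * 59 * 7207)).factorization (pp : ℕ) = 1 := by
        rw [hp, WRow.factorization_frey1618481116086272 (by norm_num)]; norm_num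
      rw [hfac'] at hord; push_cast at hord
      have hne : ∀ c : ℕ, (eF pp : ℤ) ≠ (((pp : ℕ) : ℕ) : ℤ) ^ c * ((((pp : ℕ) : ℕ) : ℤ) - 1) :=
        WRow.natCast_ne_pow_mul_sub_one Nat.prime_five pp.2 (by rw [hp]; norm_num) (by rw [hp]; norm_num) ⟨3 * l * m, by rw [hm]; ring⟩
      refine ⟨hE, ?_, ?_, ?_, by rw [h3]; push_cast at hord ⊢; linarith [hord], ⟨15 * m, by rw [h3, hm]; ring⟩⟩
      · rw [show DF pp = eF pp - 1 by simp [hDF]]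
        exact Cor312Prov.pred_div_le_differentOrd_of_eq (pp : ℕ) hE
      · rw [show rinF pp = 1 by simp [hrinF, hp]]
        exact WRow.inner_witness_trivial (pp : ℕ) _ (eF pp)
      · exact WRow.outer_member_min (pp : ℕ) hE hne 0 1 (show (((pp : ℕ) : ℕ) : ℤ) = 23 by exact_mod_cast hp) (by simp [hroutF, hp])
    · -- `p = 31`: `e = 15·l·m`, `h = 4`
      simp only [hp] at hm; norm_num at hm
      have h3 : hF pp = 4 := by simp [hhF, hp]
      have hfac' : (2 ^ 46 * 23 * (3 ^ 9 * 5 ^ 5 * 11 ^ 7 * 31 ^ 2 * 43) * (19 ^ 11 * 59 * 7207)).factorization (pp : ℕ) = 2 := by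
        rw [hp, WRow.factorization_frey1618481116086272 (by norm_num)]; norm_num
      rw [hfac'] at hord; push_cast at hord
      have hne : ∀ c : ℕ, (eF pp : ℤ) ≠ (((pp : ℕ) : ℕ) : ℤ) ^ c * ((((pp : ℕ) : ℕ) : ℤ) - 1) :=
        WRow.natCast_ne_pow_mul_sub_one hlP pp.2 (fun h => hpl h.symm)
          (fun h => by rw [hp] at h; have := Nat.le_of_dvd (by norm_num) h; omega) ⟨15 * m, by rw [hm]; ring⟩
      refine ⟨hE, ?_, ?_, ?_, by rw [h3]; push_cast at hord ⊢; linarith [hord], ⟨30 * m, by rw [h3, hm]; ring⟩⟩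
      · rw [show DF pp = eF pp - 1 by simp [hDF]]
        exact Cor312Prov.pred_div_le_differentOrd_of_eq (pp : ℕ) hE
      · rw [show rinF pp = 1 by simp [hrinF, hp]]
        exact WRow.inner_witness_trivial (pp : ℕ) _ (eF pp)
      · exact WRow.outer_member_min (pp : ℕ) hE hne 1 2 (show (((pp : ℕ) : ℕ) : ℤ) = 31 by exact_mod_cast hp) (by simp [hroutF, hp])
    · -- `p = 43`: `e = 15·l·m`, `h = 2`
      simp only [hp] at hm; norm_num at hm
      have h3 : hF pp = 2 := by simp [hhF, hp]
      have hfac' : (2 ^ 46 * 23 * (3 ^ 9 * 5 ^ 5 * 11 ^ 7 * 31 ^ 2 * 43) * (19 ^ 11 * 59 * 7207)).factorization (pp : ℕ) = 1 := by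
        rw [hp, WRow.factorization_frey1618481116086272 (by norm_num)]; norm_num
      rw [hfac'] at hord; push_cast at hord
      have hne : ∀ c : ℕ, (eF pp : ℤ) ≠ (((pp : ℕ) : ℕ) : ℤ) ^ c * ((((pp : ℕ) : ℕ) : ℤ) - 1) :=
        WRow.natCast_ne_pow_mul_sub_one Nat.prime_five pp.2 (by rw [hp]; norm_num) (by rw [hp]; norm_num) ⟨3 * l * m, by rw [hm]; ring⟩
      refine ⟨hE, ?_, ?_, ?_, by rw [h3]; push_cast at hord ⊢; linarith [hord], ⟨15 * m, by rw [h3, hm]; ring⟩⟩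
      · rw [show DF pp = eF pp - 1 by simp [hDF]]
        exact Cor312Prov.pred_div_le_differentOrd_of_eq (pp : ℕ) hE
      · rw [show rinF pp = 1 by simp [hrinF, hp]]
        exact WRow.inner_witness_trivial (pp : ℕ) _ (eF pp)
      · exact WRow.outer_member_min (pp : ℕ) hE hne 0 1 (show (((pp : ℕ) : ℕ) : ℤ) = 43 by exact_mod_cast hp) (by simp [hroutF, hp])
    · -- `p = 59`: `e = 30·l·m`, `h = 2`
      simp only [hp] at hm; norm_num at hm
      have h3 : hF pp = 2 := by simp [hhF, hp]
      have hfac' : (2 ^ 46 * 23 * (3 ^ 9 * 5 ^ 5 * 11 ^ 7 * 31 ^ 2 * 43) * (19 ^ 11 * 59 * 7207)).factorization (pp : ℕ) = 1 := by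
        rw [hp, WRow.factorization_frey1618481116086272 (by norm_num)]; norm_num
      rw [hfac'] at hord; push_cast at hord
      have hne : ∀ c : ℕ, (eF pp : ℤ) ≠ (((pp : ℕ) : ℕ) : ℤ) ^ c * ((((pp : ℕ) : ℕ) : ℤ) - 1) :=
        WRow.natCast_ne_pow_mul_sub_one Nat.prime_five pp.2 (by rw [hp]; norm_num) (by rw [hp]; norm_num) ⟨6 * l * m, by rw [hm]; ring⟩
      refine ⟨hE, ?_, ?_, ?_, by rw [h3]; push_cast at hord ⊢; linarith [hord], ⟨30 * m, by rw [h3, hm]; ring⟩⟩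
      · rw [show DF pp = eF pp - 1 by simp [hDF]]
        exact Cor312Prov.pred_div_le_differentOrd_of_eq (pp : ℕ) hE
      · rw [show rinF pp = 1 by simp [hrinF, hp]]
        exact WRow.inner_witness_trivial (pp : ℕ) _ (eF pp)
      · exact WRow.outer_member_min (pp : ℕ) hE hne 0 1 (show (((pp : ℕ) : ℕ) : ℤ) = 59 by exact_mod_cast hp) (by simp [hroutF, hp])
    · -- `p = 7207`: `e = 30·l·m`, `h = 2`
      simp only [hp] at hm; norm_num at hm
      have h3 : hF pp = 2 := by simp [hhF, hp]
      have hfac' : (2 ^ 46 * 23 * (3 ^ 9 * 5 ^ 5 * 11 ^ 7 * 31 ^ 2 * 43) * (19 ^ 11 * 59 * 7207)).factorization (pp : ℕ) = 1 := by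
        rw [hp, WRow.factorization_frey1618481116086272 (by norm_num)]; norm_num
      rw [hfac'] at hord; push_cast at hord
      have hne : ∀ c : ℕ, (eF pp : ℤ) ≠ (((pp : ℕ) : ℕ) : ℤ) ^ c * ((((pp : ℕ) : ℕ) : ℤ) - 1) :=
        WRow.natCast_ne_pow_mul_sub_one Nat.prime_five pp.2 (by rw [hp]; norm_num) (by rw [hp]; norm_num) ⟨6 * l * m, by rw [hm]; ring⟩
      refine ⟨hE, ?_, ?_, ?_, by rw [h3]; push_cast at hord ⊢; linarith [hord], ⟨30 * m, by rw [h3, hm]; ring⟩⟩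
      · rw [show DF pp = eF pp - 1 by simp [hDF]]
        exact Cor312Prov.pred_div_le_differentOrd_of_eq (pp : ℕ) hE
      · rw [show rinF pp = 1 by simp [hrinF, hp]]
        exact WRow.inner_witness_trivial (pp : ℕ) _ (eF pp)
      · exact WRow.outer_member_min (pp : ℕ) hE hne 0 1 (show (((pp : ℕ) : ℕ) : ℤ) = 7207 by exact_mod_cast hp) (by simp [hroutF, hp])
  · -- the integer cells at every label `j = i + 1 ≤ (l−1)/2`, every level `l ≥ 148540`
    haveI : Fact (pp : ℕ).Prime := ⟨pp.2⟩
    obtain ⟨x, hx⟩ := hpp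
    have hi : (i : ℕ) < (l - 1) / 2 := hlstar ▸ i.isLt
    generalize hk : (i : ℕ) = k at hi ⊢
    obtain ⟨m, hm1, hm⟩ := hshape pp x hx
    obtain ⟨-, -, -, hcases, -⟩ := WRow.bad_prime_frey1618481116086272 T pp x hx
    rcases hcases with hp | hp | hp | hp | hp | hp | hp | hp | hp
    · simp only [hp] at hm; norm_num at hm
      have h2 : DF pp = 10 * l * m - 1 := by simp [hDF, hm]
      have h3 : hF pp = 18 := by simp [hhF, hp]
      have h4 : rinF pp = (1 : ℤ) := by simp [hrinF, hp]
      have h5 : routF pp = min ((3 : ℤ) ^ 4 - 4 * (eF pp : ℤ)) ((3 : ℤ) ^ 5 - 5 * (eF pp : ℤ)) := by simp [hroutF, hp]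
      rw [h2, h3, h4, h5, hm]
      exact InhBand.cell_frey1618481116086272_p3 hL hm1 k hi
    · simp only [hp] at hm; norm_num at hm
      have h2 : DF pp = 12 * l * m - 1 := by simp [hDF, hm]
      have h3 : hF pp = 10 := by simp [hhF, hp]
      have h4 : rinF pp = (1 : ℤ) := by simp [hrinF, hp]
      have h5 : routF pp = min ((5 : ℤ) ^ 2 - 2 * (eF pp : ℤ)) ((5 : ℤ) ^ 3 - 3 * (eF pp : ℤ)) := by simp [hroutF, hp]
      rw [h2, h3, h4, h5, hm]
      exact InhBand.cell_frey1618481116086272_p5 hL hm1 k hi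
    · simp only [hp] at hm; norm_num at hm
      have h2 : DF pp = 15 * l * m - 1 := by simp [hDF, hm]
      have h3 : hF pp = 14 := by simp [hhF, hp]
      have h4 : rinF pp = (1 : ℤ) := by simp [hrinF, hp]
      have h5 : routF pp = min ((11 : ℤ) ^ 3 - 3 * (eF pp : ℤ)) ((11 : ℤ) ^ 4 - 4 * (eF pp : ℤ)) := by simp [hroutF, hp]
      rw [h2, h3, h4, h5, hm]
      exact InhBand.cell_frey1618481116086272_p11 hL hm1 k hi
    · simp only [hp] at hm; norm_num at hm
      have h2 : DF pp = 30 * l * m - 1 := by simp [hDF, hm]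
      have h3 : hF pp = 22 := by simp [hhF, hp]
      have h4 : rinF pp = (((30 * l * m / 18 : ℕ)) : ℤ) := by simp [hrinF, hp, hm]
      have h5 : routF pp = min ((19 : ℤ) ^ 5 - 5 * (eF pp : ℤ)) ((19 : ℤ) ^ 6 - 6 * (eF pp : ℤ)) := by simp [hroutF, hp]
      rw [h2, h3, h4, h5, hm]
      exact InhBand.cell_frey1618481116086272_p19 hL hm1 k hi
    · simp only [hp] at hm; norm_num at hm
      have h2 : DF pp = 15 * l * m - 1 := by simp [hDF, hm]
      have h3 : hF pp = 2 := by simp [hhF, hp]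
      have h4 : rinF pp = (1 : ℤ) := by simp [hrinF, hp]
      have h5 : routF pp = min ((23 : ℤ) ^ 0 - 0 * (eF pp : ℤ)) ((23 : ℤ) ^ 1 - 1 * (eF pp : ℤ)) := by simp [hroutF, hp]
      rw [h2, h3, h4, h5, hm]
      exact InhBand.cell_frey1618481116086272_p23 hL hm1 k hi
    · simp only [hp] at hm; norm_num at hm
      have h2 : DF pp = 15 * l * m - 1 := by simp [hDF, hm]
      have h3 : hF pp = 4 := by simp [hhF, hp]
      have h4 : rinF pp = (1 : ℤ) := by simp [hrinF, hp]
      have h5 : routF pp = min ((31 : ℤ) ^ 1 - 1 * (eF pp : ℤ)) ((31 : ℤ) ^ 2 - 2 * (eF pp : ℤ)) := by simp [hroutF, hp]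
      rw [h2, h3, h4, h5, hm]
      exact InhBand.cell_frey1618481116086272_p31 hL hm1 k hi
    · simp only [hp] at hm; norm_num at hm
      have h2 : DF pp = 15 * l * m - 1 := by simp [hDF, hm]
      have h3 : hF pp = 2 := by simp [hhF, hp]
      have h4 : rinF pp = (1 : ℤ) := by simp [hrinF, hp]
      have h5 : routF pp = min ((43 : ℤ) ^ 0 - 0 * (eF pp : ℤ)) ((43 : ℤ) ^ 1 - 1 * (eF pp : ℤ)) := by simp [hroutF, hp]
      rw [h2, h3, h4, h5, hm]
      exact InhBand.cell_frey1618481116086272_p43 hL hm1 k hi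
    · simp only [hp] at hm; norm_num at hm
      have h2 : DF pp = 30 * l * m - 1 := by simp [hDF, hm]
      have h3 : hF pp = 2 := by simp [hhF, hp]
      have h4 : rinF pp = (1 : ℤ) := by simp [hrinF, hp]
      have h5 : routF pp = min ((59 : ℤ) ^ 0 - 0 * (eF pp : ℤ)) ((59 : ℤ) ^ 1 - 1 * (eF pp : ℤ)) := by simp [hroutF, hp]
      rw [h2, h3, h4, h5, hm]
      exact InhBand.cell_frey1618481116086272_p59 hL hm1 k hi
    · simp only [hp] at hm; norm_num at hm
      have h2 : DF pp = 30 * l * m - 1 := by simp [hDF, hm]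
      have h3 : hF pp = 2 := by simp [hhF, hp]
      have h4 : rinF pp = (1 : ℤ) := by simp [hrinF, hp]
      have h5 : routF pp = min ((7207 : ℤ) ^ 0 - 0 * (eF pp : ℤ)) ((7207 : ℤ) ^ 1 - 1 * (eF pp : ℤ)) := by simp [hroutF, hp]
      rw [h2, h3, h4, h5, hm]
      exact InhBand.cell_frey1618481116086272_p7207 hL hm1 k hi

end Summit.ABC.IUTFork.Conditional

end
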